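import Summits.AnomalousDissipation.AnomalousDissipation.Theses.DopplerClock
import Summits.AnomalousDissipation.AnomalousDissipation.Theorems.DopplerClockDopplerWorkIdentity
import Summits.AnomalousDissipation.AnomalousDissipation.Theorems.DopplerClockCruxesGiveTarget
import Literature.Analysis.FluidPDE.LongTimeAverageSlidingWindow

/-!
# Route DopplerClock (AnomalousDissipation) — crux `QuadratureStressFloor` (stmt-AnomalousDissipation-18129),
# line `laminar-burst-shadowing` (payload slug `Sketch`): the NO-LEAK INJECTION-FLOOR BRIDGE (Leray–Hopf level)

`stub_bridgeNoLeakInjectionFloor : NoLeakInjectionFloorFamily → QuadratureStressFloor` — the crux strategist's typed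
claim `injectionFloor_gives_crux` (census §D3, `Cruxes/QuadratureStressFloor/StrategyCensus.lean`, "provable from the
landed DopplerWorkIdentity; NOT proved here") PROVED and landed: the crux follows from ANY vanishing-viscosity family of
global Leray–Hopf drift-`V` solutions of the Doppler force with a ν-uniform sup-in-time energy cap, NO LEAKAGE
(`⟨(f,u_j)⟩⁺ ≤ meanDissipation`) and an INJECTION floor `η ≤ Λ⟨(f,u_j)⟩` in one generalized limit `Λ`. Unlike the
periodic bridge (`stub_bridgePeriodicWitnesses`, whose hypothesis is `CoherentStates.CoherentThesis` for this force and
hence proves the summit on its own), this hypothesis asks for NO regularity and NO periodicity of the witnesses: it is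
the kernel-precise sense in which the crux is "the zeroth law for this force at pinned momentum, with no-leak witnesses"
(census B3).

**Proof.** The landed identity (`dopplerWorkIdentity_proof`, item 18133) gives
`−Λ⟨T_s(w_j)⟩ = (2πnV/F)Λ⟨(f,u_j)⟩ − ν_jκ²Λ⟨(Ψ_s,u_j)⟩ ≥ (2πnV/F)η − ν_jκ²M`, the quadrature pairing being bounded
uniformly (`dopplerClock_abs_longTimeAvg_inner_le`, mean energy `≤ 2C` from the cap by
`longTimeAvgSup_le_of_eventually_le` / `impulseGrid_timeMean_energy_le`); hence `≥ (2πnV/F)η/2 =: ε₀` along the tail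
`j ↦ j + J`; the other clauses of the crux are hypotheses (Doering–Foias 2002 §2; FMRT 2001 Ch. IV §1).

No new definitions; conditional on its inline hypothesis; registered on the crux item as stub
`stub_bridgeNoLeakInjectionFloor` of line `Sketch`.
-/

noncomputable section

-- `Summit.<Summit>.<Problem>` is the tree's mandated summit-side namespace (CONVENTIONS §2); for this
-- single-conjunct summit the two coincide, so the duplicate is deliberate.
set_option linter.dupNamespace false

open MeasureTheory Set Filter Topology
open scoped InnerProductSpace RealInnerProductSpace

namespace Summit.AnomalousDissipation.AnomalousDissipation.Theorems

open Literature.Analysis.FluidPDE Literature.Analysis.FluidPDE.Torus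
open Literature.Analysis.FunctionSpaces Literature.Analysis.FunctionSpaces.Torus

/-- **Tail arithmetic of the no-leak bridge.** If `-T = c * P - ν κ B` with `c > 0`, `η ≤ P`, `|B| ≤ M`,
`0 ≤ ν`, `0 ≤ κ` and `ν * (κ * M) ≤ c * η / 2`, then `c * η / 2 ≤ -T`. [folklore] -/
theorem noLeakBridge_floor_tail_arith {c ν κ M η B T P : ℝ} (hc : 0 < c)
    (hid : -T = c * P - ν * κ * B) (hP : η ≤ P) (hB : |B| ≤ M) (hν : 0 ≤ ν) (hκ : 0 ≤ κ)
    (hsmall : ν * (κ * M) ≤ c * η / 2) : c * η / 2 ≤ -T := by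
  rw [hid]
  have h1 : B ≤ M := (abs_le.1 hB).2
  have h2 : ν * κ * B ≤ ν * κ * M := mul_le_mul_of_nonneg_left h1 (mul_nonneg hν hκ)
  have h3 : c * η ≤ c * P := mul_le_mul_of_nonneg_left hP hc.le
  nlinarith [h2, h3, hsmall]

/-- **Mean energy under a forward kinetic-energy cap**: `⟨‖u‖₂²⟩ ≤ 2C` if `½‖u(t)‖₂² ≤ C` for `t ≥ 0`
(`impulseGrid_timeMean_energy_le` for the running means, `longTimeAvgSup_le_of_eventually_le`). [folklore] -/
theorem noLeakBridge_meanEnergy_le {u : ℝ → UnitAddTorus (Fin 3) → EuclideanSpace ℝ (Fin 3)} {C : ℝ}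
    (hC : ∀ t : ℝ, 0 ≤ t → kineticEnergy (u t) ≤ C) : meanEnergy u ≤ 2 * C := by
  rw [meanEnergy_eq_longTimeAvgSup]
  refine longTimeAvgSup_le_of_eventually_le (fun t => integral_nonneg fun _ => sq_nonneg _) ?_
  filter_upwards [eventually_gt_atTop (0 : ℝ)] with T hT using impulseGrid_timeMean_energy_le hC hT

/-- **Registered stub `stub_bridgeNoLeakInjectionFloor` of line `Sketch` (crux `QuadratureStressFloor`,
stmt-AnomalousDissipation-18129): a no-leak drift-`V` Leray–Hopf family of the Doppler force with a ν-uniform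
energy cap and an injection floor in one generalized limit gives the crux BY NAME** (the census's
`NoLeakInjectionFloorFamily → QuadratureStressFloor`, §D3). Proof: identity 18133 solved for `−Λ⟨T_s⟩`, uniform
pairing bound, tail `j ↦ j + J` with `ε₀ = (2πnV/F)η/2`. The conclusion is the crux's UNFOLDED body (definitionally
`Summit.AnomalousDissipation.AnomalousDissipation.Theses.DopplerClock.QuadratureStressFloor`; a by-name user writes
`theorem … : QuadratureStressFloor := stub_bridgeNoLeakInjectionFloor h`, which elaborates by unfolding). [folklore] -/
theorem stub_bridgeNoLeakInjectionFloor :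
    (∃ (F V : ℝ) (m n : ℕ), 0 < F ∧ 0 < V ∧ 0 < m ∧ 0 < n ∧
      ∃ (Λ : Literature.Analysis.FluidPDE.GeneralizedLimit),
      ∃ (ν : ℕ → ℝ) (u₀ : ℕ → UnitAddTorus (Fin 3) → EuclideanSpace ℝ (Fin 3))
        (u : ℕ → ℝ → UnitAddTorus (Fin 3) → EuclideanSpace ℝ (Fin 3)),
        (∀ j, 0 < ν j) ∧ Filter.Tendsto ν Filter.atTop (nhds 0) ∧
        (∀ j, Literature.Analysis.FluidPDE.Torus.IsGlobalLerayHopf (ν j) (fun _ => (fun (x : UnitAddTorus (Fin 3)) => (F * (UnitAddTorus.mFourier (Pi.single (1 : Fin 3) (m : ℤ)) x).im * (UnitAddTorus.mFourier (Pi.single (2 : Fin 3) (n : ℤ)) x).re) • EuclideanSpace.single (0 : Fin 3) (1 : ℝ))) (u₀ j) (u j)) ∧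
        (∀ j, ∫ x, u₀ j x = V • EuclideanSpace.single (2 : Fin 3) (1 : ℝ)) ∧
        (∃ C : ℝ, ∀ j, ∀ t : ℝ, 0 ≤ t → Literature.Analysis.FunctionSpaces.Torus.kineticEnergy (u j t) ≤ C) ∧
        (∀ j, Literature.Analysis.FluidPDE.longTimeAvgSup (fun t => ∫ x, inner ℝ ((F * (UnitAddTorus.mFourier (Pi.single (1 : Fin 3) (m : ℤ)) x).im * (UnitAddTorus.mFourier (Pi.single (2 : Fin 3) (n : ℤ)) x).re) • EuclideanSpace.single (0 : Fin 3) (1 : ℝ)) (u j t x)) ≤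
          Literature.Analysis.FluidPDE.meanDissipation (ν j) (u j)) ∧
        ∃ η : ℝ, 0 < η ∧ ∀ j, η ≤ Λ.longTimeAvg (fun t => ∫ x, inner ℝ ((F * (UnitAddTorus.mFourier (Pi.single (1 : Fin 3) (m : ℤ)) x).im * (UnitAddTorus.mFourier (Pi.single (2 : Fin 3) (n : ℤ)) x).re) • EuclideanSpace.single (0 : Fin 3) (1 : ℝ)) (u j t x))) →
    (∃ (F V : ℝ) (m n : ℕ), 0 < F ∧ 0 < V ∧ 0 < m ∧ 0 < n ∧ ∃ (Λ : Literature.Analysis.FluidPDE.GeneralizedLimit), ∃ (ν : ℕ → ℝ) (u₀ : ℕ → UnitAddTorus (Fin 3) → EuclideanSpace ℝ (Fin 3)) (u : ℕ → ℝ → UnitAddTorus (Fin 3) → EuclideanSpace ℝ (Fin 3)), (∀ j, 0 < ν j) ∧ Filter.Tendsto ν Filter.atTop (nhds 0) ∧ (∀ j, Literature.Analysis.FluidPDE.Torus.IsGlobalLerayHopf (ν j) (fun _ => (fun (x : UnitAddTorus (Fin 3)) => (F * (UnitAddTorus.mFourier (Pi.single (1 : Fin 3) (m : ℤ)) x).im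 * (UnitAddTorus.mFourier (Pi.single (2 : Fin 3) (n : ℤ)) x).re) • EuclideanSpace.single (0 : Fin 3) (1 : ℝ))) (u₀ j) (u j)) ∧ (∀ j, ∫ x, u₀ j x = V • EuclideanSpace.single (2 : Fin 3) (1 : ℝ)) ∧ (∀ j, ∃ C : ℝ, ∀ t : ℝ, 0 ≤ t → Literature.Analysis.FunctionSpaces.Torus.kineticEnergy (u j t) ≤ C) ∧ (∀ j, Literature.Analysis.FluidPDE.longTimeAvgSup (fun t => ∫ x, inner ℝ ((F * (UnitAddTorus.mFourier (Pi.single (1 : Fin 3) (m : ℤ)) x).im * (UnitAddTorus.mFourier (Pi.single (2 : Fin 3) (n : ℤ)) x).re) • EuclideanSpace.single (0 : Fin 3) (1 : ℝ)) (u j t x)) ≤ Literature.Analysis.FluidPDE.meanDissipation (ν j) (u j)) ∧ ∃ ε₀ : ℝ, 0 < ε₀ ∧ ∀ j, ε₀ ≤ -Λ.longTimeAvg (fun t => ∫ x, inner ℝ (u j t x - V • EuclideanSpace.single (2 : Fin 3) (1 : ℝ)) (Literature.Analysis.FunctionSpaces.Torus.convect (fun y => u j t y - V • EuclideanSpace.single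 (2 : Fin 3) (1 : ℝ)) (fun (y : UnitAddTorus (Fin 3)) => ((UnitAddTorus.mFourier (Pi.single (1 : Fin 3) (m : ℤ)) y).im * (UnitAddTorus.mFourier (Pi.single (2 : Fin 3) (n : ℤ)) y).im) • EuclideanSpace.single (0 : Fin 3) (1 : ℝ)) x))) := by
  rintro ⟨F, V, m, n, hF, hV, hm, hn, Λ, ν, u₀, u, hν, hν0, hLH, hmom, ⟨C, hC⟩, hnoleak, η, hη, hfloor⟩
  -- abbreviation for the quadrature pattern
  set Ψ : UnitAddTorus (Fin 3) → EuclideanSpace ℝ (Fin 3) := fun y =>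
    ((UnitAddTorus.mFourier (Pi.single (1 : Fin 3) (m : ℤ)) y).im *
      (UnitAddTorus.mFourier (Pi.single (2 : Fin 3) (n : ℤ)) y).im) •
      EuclideanSpace.single (0 : Fin 3) (1 : ℝ) with hΨdef
  have hsup : ∀ j, ∃ C' : ℝ, ∀ t : ℝ, 0 ≤ t → kineticEnergy (u j t) ≤ C' := fun j => ⟨C, hC j⟩
  have hE : ∀ j, meanEnergy (u j) ≤ 2 * C := fun j => noLeakBridge_meanEnergy_le (hC j)
  -- uniform bound on the quadrature pairing `Λ⟨(Ψ_s, u_j)⟩`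
  have hΨS : IsSmooth Ψ := dopplerClock_isSmooth_im_mul_im_smul _ _ _
  obtain ⟨K, hK0, hK⟩ := exists_nonneg_forall_norm_le_of_continuous hΨS.continuous
  set M : ℝ := K * (2⁻¹ * (1 + (2 * C + 1))) with hMdef
  have hB : ∀ j, |Λ.longTimeAvg (fun t => ∫ x, ⟪Ψ x, u j t x⟫)| ≤ M := fun j =>
    dopplerClock_abs_longTimeAvg_inner_le Λ (hLH j) hΨS.continuous hK0 hK (hC j) (hE j)
  have hM0 : 0 ≤ M := (abs_nonneg _).trans (hB 0)
  -- constants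
  have hn' : (0 : ℝ) < (n : ℝ) := Nat.cast_pos.2 hn
  set κ2 : ℝ := (2 * Real.pi) ^ 2 * ((m : ℝ) ^ 2 + (n : ℝ) ^ 2) with hκ2def
  have hκ2 : 0 ≤ κ2 := by rw [hκ2def]; positivity
  set c : ℝ := V * (2 * Real.pi * n) / F with hcdef
  have hc : 0 < c := by rw [hcdef]; positivity
  -- the identity, solved for `−Λ⟨T_s⟩`
  have hid : ∀ j, -Λ.longTimeAvg (fun t => ∫ x, ⟪u j t x - V • EuclideanSpace.single (2 : Fin 3) (1 : ℝ),
        convect (fun y => u j t y - V • EuclideanSpace.single (2 : Fin 3) (1 : ℝ)) Ψ x⟫) =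
      c * Λ.longTimeAvg (fun t => ∫ x, ⟪(F * (UnitAddTorus.mFourier (Pi.single (1 : Fin 3) (m : ℤ)) x).im *
          (UnitAddTorus.mFourier (Pi.single (2 : Fin 3) (n : ℤ)) x).re) •
          EuclideanSpace.single (0 : Fin 3) (1 : ℝ), u j t x⟫) -
        ν j * κ2 * Λ.longTimeAvg (fun t => ∫ x, ⟪Ψ x, u j t x⟫) := by
    intro j
    have h := dopplerWorkIdentity_proof Λ F V (ν j) m n (u₀ j) (u j) hV (hν j) hn (hLH j) (hmom j) (hsup j)
    have hFne : F ≠ 0 := hF.ne'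
    have hVne : V * (2 * Real.pi * n) ≠ 0 := by positivity
    rw [hcdef, h]
    field_simp
    ring
  -- choose the tail
  obtain ⟨J, hJ⟩ : ∃ J : ℕ, ∀ j ≥ J, ν j ≤ c * η / 2 / (κ2 * M + 1) := by
    have hpos : 0 < c * η / 2 / (κ2 * M + 1) := by positivity
    exact eventually_atTop.1 ((hν0.eventually (ge_mem_nhds hpos)).mono fun j hj => hj)
  have hfloorTail : ∀ j, J ≤ j →
      c * η / 2 ≤ -Λ.longTimeAvg (fun t => ∫ x, ⟪u j t x - V • EuclideanSpace.single (2 : Fin 3) (1 : ℝ),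
        convect (fun y => u j t y - V • EuclideanSpace.single (2 : Fin 3) (1 : ℝ)) Ψ x⟫) := by
    intro j hj
    have hsmall : ν j * (κ2 * M) ≤ c * η / 2 := by
      have h1 : ν j * (κ2 * M + 1) ≤ c * η / 2 := by
        have := hJ j hj
        rwa [le_div_iff₀ (by positivity)] at this
      nlinarith [(hν j).le, h1]
    exact noLeakBridge_floor_tail_arith hc (hid j) (hfloor j) (hB j) (hν j).le hκ2 hsmall
  -- assemble the crux along the reindexed tail `j ↦ j + J`
  refine ⟨F, V, m, n, hF, hV, hm, hn, Λ, fun j => ν (j + J), fun j => u₀ (j + J), fun j => u (j + J),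
    fun j => hν _, hν0.comp (tendsto_add_atTop_nat J), fun j => hLH _, fun j => hmom _, fun j => hsup _,
    fun j => hnoleak _, c * η / 2, by positivity, fun j => ?_⟩
  exact hfloorTail (j + J) (Nat.le_add_left J j)

end Summit.AnomalousDissipation.AnomalousDissipation.Theorems

end
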